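import Summits.Ventures.CertifiedManyBodySolver.Downfold.EmeryAntibondingBandContinuous
import Mathlib.MeasureTheory.Integral.Indicator
import HarnessLib

/-!
# THE BAND AND THE FILLING DEPEND CONTINUOUSLY ON THE THREE-BAND PARAMETERS: joint continuity of `ε_AB` in
# `(Δ, t_pd, t_pp, t_pp′; k)`, regime-free null level sets, joint continuity of `abFilling` in `(parameters, ε)`

Venture CertifiedManyBodySolver, cell `pub/hubbard-downfold` (stage S1; INFLATION-RULES-3to1-B §B.83), seat hubbard-downfold-mod-4 (technique B,
g34); namespace `Summit.Ventures.CertifiedManyBodySolver.Downfold.Emery`. Everything PROVED (0 sorry, no definition). WHAT THIS IS NOT: a statement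
about any material; `U = 0` one-body kinematics of the σ (d–p_x–p_y + t_pp, t_pp′) model; no number lives here.

WHY. Every census row of §B.64–§B.82 is a [float] literature / DFT parameter set TRANSCRIBED as exact rationals, and every kernel statement is
about that rational point. This file proves that the objects read off the row move CONTINUOUSLY with the row, so the transcription is harmless in
the limit and interval (box) versions are meaningful: parameters `θ = (Δ, t_pd, t_pp, t_pp′)`, region `Δ > 0`, `t_pd ≠ 0`, `t_pp, t_pp′ ≥ 0`.

* §1 REGIME-FREE NULL LEVEL SETS: at ANY energy `ε` with `ε ≠ 0`, `ε ≠ −Δ` (so `cA(ε) = ε(Δ + ε)² ≠ 0`) the zero set of the secular cubic in the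
  quadrant is Lebesgue-null (`volume_zeroSet_eq_zero_of_cA_ne`: on each line `k_x = const` the cubic is affine in `y` with coefficient
  `4fsD + 16fsN·x`, which vanishes for at most ONE `x` unless `fsD = fsN = 0`, in which case the zero set is empty) ⇒ `volume(Q ∩ {ε_AB = ε}) = 0`
  (`volume_levelSet_eq_zero_of_ne`) and `abFilling` is continuous at every `ε > 0` for `Δ ≥ 0` (`continuousAt_abFilling_of_pos`) — the
  `fsD ≥ 0, fsN > 0` regime of `EmeryFermiEnergyExists` is not needed.
* §2 **THE ANTIBONDING BAND IS JOINTLY CONTINUOUS IN (PARAMETERS, k)** at every `(θ₀, k₀)` of the region (`continuousAt_abEnergy_param`: upper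
  semicontinuity everywhere from `EmeryAntibondingBandBorel`; lower semicontinuity from the sign characterisation of
  `EmeryAntibondingBandContinuous` at a positive test energy, and at `Γ` from `charCubic(0, 0, t) = t(t + Δ)² < 0` for `−Δ < t < 0`).
* §3 **THE FILLING IS JOINTLY CONTINUOUS IN (PARAMETERS, ENERGY)** at every `(θ₀, ε₀)` with `ε₀ > 0` (`continuousAt_abFilling_param`:
  dominated convergence of indicators, `tendsto_measure_of_ae_tendsto_indicator`, off the null level set of §1).
* (sequel `EmeryFermiEnergyStable`: the Fermi energy is stable / continuous in the row.)

Sources: three-band model [HybertsenSchluterChristensen1989, Eq. (1)]; [AndersenEtAl1995, §6]; dominated convergence / Tonelli [folklore].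
-/

noncomputable section

namespace Summit.Ventures.CertifiedManyBodySolver.Downfold.Emery

open Real MeasureTheory Set Filter Topology
open scoped ENNReal

/-! ## §1 Regime-free null level sets and continuity of the filling at every positive energy -/

section Null

variable {Δ a b c ε : ℝ}

/-- On a line `k_x = k₁` where the `y`-coefficient `4fsD + 16fsN·x(k₁)` is non-zero, the zero set of the secular cubic in the quadrant has
at most one point. [folklore] -/
theorem zeroSet_section_subsingleton_of_ne {k₁ : ℝ} (hβ : 4 * fsD Δ a c ε + 16 * fsN a b c ε * halfSq k₁ ≠ 0) :
    (Prod.mk k₁ ⁻¹' (bzQuad ∩ {k : ℝ × ℝ | charCubic Δ a b c (halfSq k.1) (halfSq k.2) ε = 0})).Subsingleton := by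
  intro k₂ hk₂ k₂' hk₂'
  simp only [mem_preimage, mem_inter_iff, bzQuad, mem_prod, mem_Icc, mem_setOf_eq] at hk₂ hk₂'
  obtain ⟨⟨-, ⟨h2l, h2r⟩⟩, hz⟩ := hk₂
  obtain ⟨⟨-, ⟨h2l', h2r'⟩⟩, hz'⟩ := hk₂'
  rw [charCubic_section] at hz hz'
  have hy : halfSq k₂ = halfSq k₂' := by
    have hm : (halfSq k₂ - halfSq k₂') * (4 * fsD Δ a c ε + 16 * fsN a b c ε * halfSq k₁) = 0 := by linarith
    rcases mul_eq_zero.mp hm with h | h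
    · linarith
    · exact absurd h hβ
  exact halfSq_injOn ⟨h2l, h2r⟩ ⟨h2l', h2r'⟩ hy

/-- **THE ZERO SET OF THE SECULAR CUBIC IS NULL whenever `cA(ε) ≠ 0`** (no sign regime): the lines on which the `y`-coefficient vanishes
form a null set of `k_x` (at most one value of `sin²(k_x/2)` in `[0, π]`), unless `fsD = fsN = 0`, where the zero set is empty. [folklore] -/
theorem volume_zeroSet_eq_zero_of_cA_ne (hA : cA Δ ε ≠ 0) :
    volume (bzQuad ∩ {k : ℝ × ℝ | charCubic Δ a b c (halfSq k.1) (halfSq k.2) ε = 0}) = 0 := by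
  set Z := bzQuad ∩ {k : ℝ × ℝ | charCubic Δ a b c (halfSq k.1) (halfSq k.2) ε = 0} with hZ
  by_cases hdeg : fsD Δ a c ε = 0 ∧ fsN a b c ε = 0
  · -- degenerate: the cubic is the constant cA ≠ 0 on the quadrant
    have hempty : Z = ∅ := by
      rw [hZ, Set.eq_empty_iff_forall_notMem]
      rintro k ⟨-, hk⟩
      simp only [mem_setOf_eq, charCubic_bilinear, hdeg.1, hdeg.2] at hk
      apply hA; linarith
    rw [hempty, measure_empty]
  · rw [Measure.volume_eq_prod, Measure.prod_apply (measurableSet_zeroSet Δ a b c ε)]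
    -- the exceptional lines: k₁ ∈ [0, π] with 4fsD + 16fsN·x(k₁) = 0 — a subsingleton
    set X : Set ℝ := {k₁ : ℝ | k₁ ∈ Icc (0 : ℝ) π ∧ 4 * fsD Δ a c ε + 16 * fsN a b c ε * halfSq k₁ = 0} with hX
    have hXsub : X.Subsingleton := by
      intro k₁ hk₁ k₁' hk₁'
      rcases eq_or_ne (fsN a b c ε) 0 with hN | hN
      · exfalso
        have hD : fsD Δ a c ε = 0 := by have := hk₁.2; rw [hN] at this; linarith
        exact hdeg ⟨hD, hN⟩
      · have : halfSq k₁ = halfSq k₁' := by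
          have h1 := hk₁.2; have h2 := hk₁'.2
          have : 16 * fsN a b c ε * (halfSq k₁ - halfSq k₁') = 0 := by linarith
          rcases mul_eq_zero.mp this with h | h
          · exact absurd (by linarith : fsN a b c ε = 0) hN
          · linarith
        exact halfSq_injOn hk₁.1 hk₁'.1 this
    have hXnull : volume X = 0 := hXsub.measure_zero volume
    have hae : ∀ᵐ k₁ : ℝ ∂volume, volume (Prod.mk k₁ ⁻¹' Z) = 0 := by
      filter_upwards [compl_mem_ae_iff.mpr hXnull] with k₁ hk₁
      by_cases hin : k₁ ∈ Icc (0 : ℝ) π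
      · have hβ : 4 * fsD Δ a c ε + 16 * fsN a b c ε * halfSq k₁ ≠ 0 := fun h => hk₁ ⟨hin, h⟩
        exact (zeroSet_section_subsingleton_of_ne hβ).measure_zero volume
      · have hempty : Prod.mk k₁ ⁻¹' Z = ∅ := by
          rw [Set.eq_empty_iff_forall_notMem]
          rintro k₂ ⟨⟨h1, -⟩, -⟩
          exact hin h1
        rw [hempty, measure_empty]
    rw [lintegral_congr_ae hae, lintegral_zero]

/-- **LEVEL SETS OF THE ANTIBONDING BAND ARE NULL at every `ε ≠ 0, −Δ`** (no sign regime). [folklore] -/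
theorem volume_levelSet_eq_zero_of_ne (hε : ε ≠ 0) (hεΔ : Δ + ε ≠ 0) : volume (bzQuad ∩ {k | abEnergyK Δ a b c k = ε}) = 0 := by
  refine measure_mono_null (levelSet_subset_zeroSet Δ a b c ε) (volume_zeroSet_eq_zero_of_cA_ne ?_)
  unfold cA
  exact mul_ne_zero hε (pow_ne_zero 2 hεΔ)

/-- The closed and open sub-level parts of the quadrant have the same measure at every `ε ≠ 0, −Δ`. [folklore] -/
theorem volume_subLevel_eq_strict_of_ne (hε : ε ≠ 0) (hεΔ : Δ + ε ≠ 0) :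
    volume (bzQuad ∩ {k | abEnergyK Δ a b c k ≤ ε}) = volume (bzQuad ∩ {k | abEnergyK Δ a b c k < ε}) := by
  apply le_antisymm
  · have hsub : bzQuad ∩ {k | abEnergyK Δ a b c k ≤ ε} ⊆
        (bzQuad ∩ {k | abEnergyK Δ a b c k < ε}) ∪ (bzQuad ∩ {k | abEnergyK Δ a b c k = ε}) := by
      rintro k ⟨hk, hle⟩
      rcases (show abEnergyK Δ a b c k ≤ ε from hle).lt_or_eq with h | h
      · exact Or.inl ⟨hk, h⟩
      · exact Or.inr ⟨hk, h⟩
    calc volume (bzQuad ∩ {k | abEnergyK Δ a b c k ≤ ε})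
        ≤ volume ((bzQuad ∩ {k | abEnergyK Δ a b c k < ε}) ∪ (bzQuad ∩ {k | abEnergyK Δ a b c k = ε})) := measure_mono hsub
      _ ≤ volume (bzQuad ∩ {k | abEnergyK Δ a b c k < ε}) + volume (bzQuad ∩ {k | abEnergyK Δ a b c k = ε}) :=
          measure_union_le _ _
      _ = volume (bzQuad ∩ {k | abEnergyK Δ a b c k < ε}) := by rw [volume_levelSet_eq_zero_of_ne hε hεΔ, add_zero]
  · exact measure_mono fun k ⟨hk, h⟩ => ⟨hk, le_of_lt (show abEnergyK Δ a b c k < ε from h)⟩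

/-- **THE FILLING MAP IS CONTINUOUS AT EVERY POSITIVE ENERGY** for `Δ ≥ 0` (no further regime). [folklore] -/
theorem continuousAt_abFilling_of_pos (hΔ : 0 ≤ Δ) (hε : 0 < ε) : ContinuousAt (abFilling Δ a b c) ε := by
  set V : ℝ → ℝ := fun e => (volume (bzQuad ∩ {k | abEnergyK Δ a b c k ≤ e})).toReal with hV
  have hVfin : ∀ e, volume (bzQuad ∩ {k | abEnergyK Δ a b c k ≤ e}) ≠ ⊤ := fun e =>
    ne_top_of_le_ne_top volume_bzQuad_ne_top (measure_mono inter_subset_left)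
  have hVmono : Monotone V := by
    intro e e' h
    exact ENNReal.toReal_mono (hVfin e') (measure_mono fun k ⟨hk, hle⟩ =>
      ⟨hk, le_trans (show abEnergyK Δ a b c k ≤ e from hle) h⟩)
  have hF : abFilling Δ a b c = fun e => V e / π ^ 2 := by
    funext e; unfold abFilling; rw [abOccSet_eq]
  have hR : Tendsto (fun n : ℕ => V (ε + 1 / ((n : ℝ) + 1))) atTop (𝓝 (V ε)) :=
    (ENNReal.tendsto_toReal (hVfin ε)).comp (tendsto_volume_subLevel_right Δ a b c ε)
  have hL : Tendsto (fun n : ℕ => V (ε - 1 / ((n : ℝ) + 1))) atTop (𝓝 (V ε)) := by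
    have h := tendsto_volume_subLevel_left Δ a b c ε
    rw [← volume_subLevel_eq_strict_of_ne hε.ne' (by linarith)] at h
    exact (ENNReal.tendsto_toReal (hVfin ε)).comp h
  have hVcont : ContinuousAt V ε := by
    rw [Metric.continuousAt_iff]
    intro η hη
    obtain ⟨n₁, hn₁⟩ := Metric.tendsto_atTop.mp hR η hη
    obtain ⟨n₂, hn₂⟩ := Metric.tendsto_atTop.mp hL η hη
    have h₁ := hn₁ n₁ le_rfl
    have h₂ := hn₂ n₂ le_rfl
    rw [Real.dist_eq] at h₁ h₂
    refine ⟨min (1 / ((n₁ : ℝ) + 1)) (1 / ((n₂ : ℝ) + 1)), by positivity, fun e he => ?_⟩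
    rw [Real.dist_eq] at he ⊢
    have hlo : ε - 1 / ((n₂ : ℝ) + 1) ≤ e := by
      have := (abs_lt.mp he).1; have := min_le_right (1 / ((n₁ : ℝ) + 1)) (1 / ((n₂ : ℝ) + 1)); linarith
    have hhi : e ≤ ε + 1 / ((n₁ : ℝ) + 1) := by
      have := (abs_lt.mp he).2; have := min_le_left (1 / ((n₁ : ℝ) + 1)) (1 / ((n₂ : ℝ) + 1)); linarith
    have m1 := hVmono hlo
    have m2 := hVmono hhi
    have a1 := (abs_lt.mp h₁).2
    have a2 := (abs_lt.mp h₂).1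
    rw [abs_lt]; constructor <;> linarith
  rw [hF]
  exact hVcont.div_const _

end Null

/-! ## §2 The antibonding band is jointly continuous in (parameters, k) -/

/-- Continuity of `(θ, k) ↦ charCubic(θ; sin²(k_x/2), sin²(k_y/2); t)` (`θ = (Δ, t_pd, t_pp, t_pp′)`). [folklore] -/
theorem continuous_charCubic_param (t : ℝ) : Continuous fun q : (ℝ × ℝ × ℝ × ℝ) × (ℝ × ℝ) =>
    charCubic q.1.1 q.1.2.1 q.1.2.2.1 q.1.2.2.2 (halfSq q.2.1) (halfSq q.2.2) t := by
  have h1 : Continuous fun q : (ℝ × ℝ × ℝ × ℝ) × (ℝ × ℝ) => halfSq q.2.1 := continuous_halfSq.comp (continuous_fst.comp continuous_snd)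
  have h2 : Continuous fun q : (ℝ × ℝ × ℝ × ℝ) × (ℝ × ℝ) => halfSq q.2.2 := continuous_halfSq.comp (continuous_snd.comp continuous_snd)
  unfold charCubic; fun_prop

/-- The antibonding band is upper semicontinuous JOINTLY in (parameters, k), everywhere. [folklore] -/
theorem upperSemicontinuous_abEnergy_param : UpperSemicontinuous fun q : (ℝ × ℝ × ℝ × ℝ) × (ℝ × ℝ) =>
    abEnergyK q.1.1 q.1.2.1 q.1.2.2.1 q.1.2.2.2 q.2 := by
  have hco : Continuous fun q : (ℝ × ℝ × ℝ × ℝ) × (ℝ × ℝ) =>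
      (cubA q.1.1 q.1.2.2.2 (halfSq q.2.1) (halfSq q.2.2), cubB q.1.1 q.1.2.1 q.1.2.2.1 q.1.2.2.2 (halfSq q.2.1) (halfSq q.2.2),
        cubD q.1.1 q.1.2.1 q.1.2.2.1 q.1.2.2.2 (halfSq q.2.1) (halfSq q.2.2)) := by
    have h1 : Continuous fun q : (ℝ × ℝ × ℝ × ℝ) × (ℝ × ℝ) => halfSq q.2.1 := continuous_halfSq.comp (continuous_fst.comp continuous_snd)
    have h2 : Continuous fun q : (ℝ × ℝ × ℝ × ℝ) × (ℝ × ℝ) => halfSq q.2.2 := continuous_halfSq.comp (continuous_snd.comp continuous_snd)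
    unfold cubA cubB cubD; fun_prop
  have heq : (fun q : (ℝ × ℝ × ℝ × ℝ) × (ℝ × ℝ) => abEnergyK q.1.1 q.1.2.1 q.1.2.2.1 q.1.2.2.2 q.2) =
      (fun p : ℝ × ℝ × ℝ => topRoot p.1 p.2.1 p.2.2) ∘ fun q : (ℝ × ℝ × ℝ × ℝ) × (ℝ × ℝ) =>
        (cubA q.1.1 q.1.2.2.2 (halfSq q.2.1) (halfSq q.2.2), cubB q.1.1 q.1.2.1 q.1.2.2.1 q.1.2.2.2 (halfSq q.2.1) (halfSq q.2.2),
          cubD q.1.1 q.1.2.1 q.1.2.2.1 q.1.2.2.2 (halfSq q.2.1) (halfSq q.2.2)) := by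
    funext q; rfl
  rw [heq]
  exact upperSemicontinuous_topRoot3.comp hco

/-- **THE ANTIBONDING BAND IS JOINTLY CONTINUOUS IN (PARAMETERS, k)** at every `(θ₀, k₀)` with `Δ₀ > 0`, `t_pd,0 ≠ 0`, `t_pp,0, t_pp′,0 ≥ 0`.
[folklore] -/
theorem continuousAt_abEnergy_param {θ₀ : ℝ × ℝ × ℝ × ℝ} (hΔ : 0 < θ₀.1) (ha : θ₀.2.1 ≠ 0) (hb : 0 ≤ θ₀.2.2.1) (hc : 0 ≤ θ₀.2.2.2)
    (k₀ : ℝ × ℝ) : ContinuousAt (fun q : (ℝ × ℝ × ℝ × ℝ) × (ℝ × ℝ) => abEnergyK q.1.1 q.1.2.1 q.1.2.2.1 q.1.2.2.2 q.2) (θ₀, k₀) := by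
  rw [continuousAt_iff_lower_upperSemicontinuousAt]
  refine ⟨lowerSemicontinuousAt_iff.mpr fun μ hμ => ?_, upperSemicontinuous_abEnergy_param (θ₀, k₀)⟩
  obtain ⟨Δ₀, a₀, b₀, c₀⟩ := θ₀
  simp only at hΔ ha hb hc hμ ⊢
  -- a test energy t ∈ (μ, E₀) at which the cubic of the base point is negative
  have key : ∃ t : ℝ, μ < t ∧ charCubic Δ₀ a₀ b₀ c₀ (halfSq k₀.1) (halfSq k₀.2) t < 0 := by
    by_cases hE : 0 < abEnergyK Δ₀ a₀ b₀ c₀ k₀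
    · set t : ℝ := (max μ 0 + abEnergyK Δ₀ a₀ b₀ c₀ k₀) / 2 with ht
      have hmax : max μ 0 < abEnergyK Δ₀ a₀ b₀ c₀ k₀ := max_lt hμ hE
      refine ⟨t, by rw [ht]; linarith [le_max_left μ 0], ?_⟩
      exact charCubic_neg_of_pos_of_lt_abBand hΔ.le hc hb (halfSq_nonneg _) (halfSq_nonneg _)
        (by rw [ht]; linarith [le_max_right μ 0]) (by rw [ht]; unfold abEnergyK at hmax ⊢; linarith)
    · -- E₀ = 0: k₀ is Γ-like (x + y = 0), the cubic is t(t + Δ₀)² there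
      push Not at hE
      have hE0 : abEnergyK Δ₀ a₀ b₀ c₀ k₀ = 0 := le_antisymm hE (abEnergyK_nonneg hΔ.le hc hb k₀)
      have hxy : halfSq k₀.1 + halfSq k₀.2 = 0 := by
        by_contra hne
        have hpos : 0 < halfSq k₀.1 + halfSq k₀.2 :=
          lt_of_le_of_ne (add_nonneg (halfSq_nonneg _) (halfSq_nonneg _)) (Ne.symm hne)
        have := abBand_pos_of_sum_pos hΔ ha hc hb (halfSq_nonneg k₀.1) (halfSq_nonneg k₀.2) hpos
        unfold abEnergyK at hE0; linarith
      have hx : halfSq k₀.1 = 0 := by linarith [halfSq_nonneg k₀.1, halfSq_nonneg k₀.2]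
      have hy : halfSq k₀.2 = 0 := by linarith [halfSq_nonneg k₀.1, halfSq_nonneg k₀.2]
      rw [hE0] at hμ
      set t : ℝ := max (μ / 2) (-Δ₀ / 2) with ht
      have htμ : μ < t := lt_of_lt_of_le (by linarith) (le_max_left _ _)
      have ht0 : t < 0 := max_lt (by linarith) (by linarith)
      have htΔ : 0 < t + Δ₀ := by have := le_max_right (μ / 2) (-Δ₀ / 2); rw [← ht] at this; linarith
      refine ⟨t, htμ, ?_⟩
      rw [hx, hy, charCubic_bilinear]
      unfold cA
      have : t * (Δ₀ + t) ^ 2 < 0 := mul_neg_of_neg_of_pos ht0 (pow_pos (by linarith) 2)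
      linarith
  obtain ⟨t, htμ, hneg⟩ := key
  have hev : ∀ᶠ q : (ℝ × ℝ × ℝ × ℝ) × (ℝ × ℝ) in 𝓝 ((Δ₀, a₀, b₀, c₀), k₀),
      charCubic q.1.1 q.1.2.1 q.1.2.2.1 q.1.2.2.2 (halfSq q.2.1) (halfSq q.2.2) t < 0 :=
    ((continuous_charCubic_param t).continuousAt (x := ((Δ₀, a₀, b₀, c₀), k₀))).eventually_lt continuousAt_const (by exact hneg)
  exact hev.mono fun q hq => lt_trans htμ (lt_abBand_of_charCubic_neg hq)

/-- Continuity of the band in the parameters at fixed `k`. [folklore] -/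
theorem continuousAt_abEnergy_param_fixed {θ₀ : ℝ × ℝ × ℝ × ℝ} (hΔ : 0 < θ₀.1) (ha : θ₀.2.1 ≠ 0) (hb : 0 ≤ θ₀.2.2.1)
    (hc : 0 ≤ θ₀.2.2.2) (k : ℝ × ℝ) :
    ContinuousAt (fun θ : ℝ × ℝ × ℝ × ℝ => abEnergyK θ.1 θ.2.1 θ.2.2.1 θ.2.2.2 k) θ₀ := by
  have h := continuousAt_abEnergy_param hΔ ha hb hc k
  exact ContinuousAt.comp₂ (f := fun q : (ℝ × ℝ × ℝ × ℝ) × (ℝ × ℝ) => abEnergyK q.1.1 q.1.2.1 q.1.2.2.1 q.1.2.2.2 q.2)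
    (g := fun θ : ℝ × ℝ × ℝ × ℝ => θ) (h := fun _ : ℝ × ℝ × ℝ × ℝ => k) h continuousAt_id continuousAt_const

/-! ## §3 The filling is jointly continuous in (parameters, energy) -/

/-- **THE FILLING IS JOINTLY CONTINUOUS IN (PARAMETERS, ENERGY)** at every `(θ₀, ε₀)` with `Δ₀ > 0`, `t_pd,0 ≠ 0`, `t_pp,0, t_pp′,0 ≥ 0` and
`ε₀ > 0` (dominated convergence of the occupied-set indicators off the null Fermi surface of the base point). [folklore] -/
theorem continuousAt_abFilling_param {θ₀ : ℝ × ℝ × ℝ × ℝ} (hΔ : 0 < θ₀.1) (ha : θ₀.2.1 ≠ 0) (hb : 0 ≤ θ₀.2.2.1) (hc : 0 ≤ θ₀.2.2.2)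
    {ε₀ : ℝ} (hε : 0 < ε₀) :
    ContinuousAt (fun q : (ℝ × ℝ × ℝ × ℝ) × ℝ => abFilling q.1.1 q.1.2.1 q.1.2.2.1 q.1.2.2.2 q.2) (θ₀, ε₀) := by
  obtain ⟨Δ₀, a₀, b₀, c₀⟩ := θ₀
  simp only at hΔ ha hb hc
  set As : (ℝ × ℝ × ℝ × ℝ) × ℝ → Set (ℝ × ℝ) := fun q => bzQuad ∩ {k | abEnergyK q.1.1 q.1.2.1 q.1.2.2.1 q.1.2.2.2 k ≤ q.2} with hAs
  have hAsm : ∀ q, MeasurableSet (As q) := fun q => measurableSet_bzQuad.inter (measurableSet_subLevel _ _ _ _ _)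
  have hsub : ∀ᶠ q in 𝓝 (((Δ₀, a₀, b₀, c₀) : ℝ × ℝ × ℝ × ℝ), ε₀), As q ⊆ bzQuad := Eventually.of_forall fun q => inter_subset_left
  have hnull := volume_levelSet_eq_zero_of_ne (Δ := Δ₀) (a := a₀) (b := b₀) (c := c₀) hε.ne' (by linarith : Δ₀ + ε₀ ≠ 0)
  have hlim : ∀ᵐ k : ℝ × ℝ ∂volume, ∀ᶠ q in 𝓝 (((Δ₀, a₀, b₀, c₀) : ℝ × ℝ × ℝ × ℝ), ε₀),
      k ∈ As q ↔ k ∈ As ((Δ₀, a₀, b₀, c₀), ε₀) := by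
    filter_upwards [compl_mem_ae_iff.mpr hnull] with k hk
    by_cases hQ : k ∈ bzQuad
    · have hne : abEnergyK Δ₀ a₀ b₀ c₀ k ≠ ε₀ := fun h => hk ⟨hQ, h⟩
      have hg : ContinuousAt (fun q : (ℝ × ℝ × ℝ × ℝ) × ℝ => q.2 - abEnergyK q.1.1 q.1.2.1 q.1.2.2.1 q.1.2.2.2 k)
          (((Δ₀, a₀, b₀, c₀) : ℝ × ℝ × ℝ × ℝ), ε₀) := by
        refine ContinuousAt.sub continuousAt_snd ?_
        have h1 := continuousAt_abEnergy_param (θ₀ := (Δ₀, a₀, b₀, c₀)) hΔ ha hb hc k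
        exact ContinuousAt.comp₂ (f := fun q : (ℝ × ℝ × ℝ × ℝ) × (ℝ × ℝ) => abEnergyK q.1.1 q.1.2.1 q.1.2.2.1 q.1.2.2.2 q.2)
          (g := fun q : (ℝ × ℝ × ℝ × ℝ) × ℝ => q.1) (h := fun _ : (ℝ × ℝ × ℝ × ℝ) × ℝ => k) h1 continuousAt_fst continuousAt_const
      rcases hne.lt_or_gt with hlt | hgt
      · have hpos : (fun _ : (ℝ × ℝ × ℝ × ℝ) × ℝ => (0 : ℝ)) (((Δ₀, a₀, b₀, c₀) : ℝ × ℝ × ℝ × ℝ), ε₀) <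
            (fun q : (ℝ × ℝ × ℝ × ℝ) × ℝ => q.2 - abEnergyK q.1.1 q.1.2.1 q.1.2.2.1 q.1.2.2.2 k) (((Δ₀, a₀, b₀, c₀) : ℝ × ℝ × ℝ × ℝ), ε₀) := by
          exact (by linarith : (0 : ℝ) < ε₀ - abEnergyK Δ₀ a₀ b₀ c₀ k)
        have hev := continuousAt_const.eventually_lt hg hpos
        filter_upwards [hev] with q hq
        have hq' : (0 : ℝ) < q.2 - abEnergyK q.1.1 q.1.2.1 q.1.2.2.1 q.1.2.2.2 k := hq
        exact iff_of_true ⟨hQ, show abEnergyK q.1.1 q.1.2.1 q.1.2.2.1 q.1.2.2.2 k ≤ q.2 by linarith⟩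
          ⟨hQ, show abEnergyK Δ₀ a₀ b₀ c₀ k ≤ ε₀ from hlt.le⟩
      · have hneg : (fun q : (ℝ × ℝ × ℝ × ℝ) × ℝ => q.2 - abEnergyK q.1.1 q.1.2.1 q.1.2.2.1 q.1.2.2.2 k) (((Δ₀, a₀, b₀, c₀) : ℝ × ℝ × ℝ × ℝ), ε₀) <
            (fun _ : (ℝ × ℝ × ℝ × ℝ) × ℝ => (0 : ℝ)) (((Δ₀, a₀, b₀, c₀) : ℝ × ℝ × ℝ × ℝ), ε₀) := by
          exact (by linarith : ε₀ - abEnergyK Δ₀ a₀ b₀ c₀ k < 0)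
        have hev := hg.eventually_lt continuousAt_const hneg
        filter_upwards [hev] with q hq
        have hq' : q.2 - abEnergyK q.1.1 q.1.2.1 q.1.2.2.1 q.1.2.2.2 k < 0 := hq
        exact iff_of_false (fun h => by have h2 : abEnergyK q.1.1 q.1.2.1 q.1.2.2.1 q.1.2.2.2 k ≤ q.2 := h.2; linarith)
          (fun h => by have h2 : abEnergyK Δ₀ a₀ b₀ c₀ k ≤ ε₀ := h.2; linarith)
    · exact Eventually.of_forall fun q => iff_of_false (fun h => hQ h.1) (fun h => hQ h.1)
  have ht := tendsto_measure_of_ae_tendsto_indicator (𝓝 (((Δ₀, a₀, b₀, c₀) : ℝ × ℝ × ℝ × ℝ), ε₀))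
    (hAsm (((Δ₀, a₀, b₀, c₀) : ℝ × ℝ × ℝ × ℝ), ε₀)) hAsm measurableSet_bzQuad volume_bzQuad_ne_top hsub hlim
  have hfin : volume (As (((Δ₀, a₀, b₀, c₀) : ℝ × ℝ × ℝ × ℝ), ε₀)) ≠ ⊤ :=
    ne_top_of_le_ne_top volume_bzQuad_ne_top (measure_mono inter_subset_left)
  have hF : (fun q : (ℝ × ℝ × ℝ × ℝ) × ℝ => abFilling q.1.1 q.1.2.1 q.1.2.2.1 q.1.2.2.2 q.2) =
      fun q => (volume (As q)).toReal / π ^ 2 := by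
    funext q; unfold abFilling; rw [abOccSet_eq]
  have h3 : Tendsto (fun q : (ℝ × ℝ × ℝ × ℝ) × ℝ => (volume (As q)).toReal / π ^ 2) (𝓝 (((Δ₀, a₀, b₀, c₀) : ℝ × ℝ × ℝ × ℝ), ε₀))
      (𝓝 ((volume (As (((Δ₀, a₀, b₀, c₀) : ℝ × ℝ × ℝ × ℝ), ε₀))).toReal / π ^ 2)) :=
    ((ENNReal.tendsto_toReal hfin).comp ht).div_const _
  have hval : abFilling Δ₀ a₀ b₀ c₀ ε₀ = (volume (As (((Δ₀, a₀, b₀, c₀) : ℝ × ℝ × ℝ × ℝ), ε₀))).toReal / π ^ 2 := by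
    unfold abFilling; rw [abOccSet_eq]
  change Tendsto (fun q : (ℝ × ℝ × ℝ × ℝ) × ℝ => abFilling q.1.1 q.1.2.1 q.1.2.2.1 q.1.2.2.2 q.2)
    (𝓝 (((Δ₀, a₀, b₀, c₀) : ℝ × ℝ × ℝ × ℝ), ε₀)) (𝓝 (abFilling Δ₀ a₀ b₀ c₀ ε₀))
  rw [hF, hval]
  exact h3

/-- Continuity of the filling in the parameters at a fixed positive energy. [folklore] -/
theorem continuousAt_abFilling_param_fixed {θ₀ : ℝ × ℝ × ℝ × ℝ} (hΔ : 0 < θ₀.1) (ha : θ₀.2.1 ≠ 0) (hb : 0 ≤ θ₀.2.2.1)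
    (hc : 0 ≤ θ₀.2.2.2) {ε : ℝ} (hε : 0 < ε) :
    ContinuousAt (fun θ : ℝ × ℝ × ℝ × ℝ => abFilling θ.1 θ.2.1 θ.2.2.1 θ.2.2.2 ε) θ₀ := by
  have h := continuousAt_abFilling_param hΔ ha hb hc hε
  exact ContinuousAt.comp₂ (f := fun q : (ℝ × ℝ × ℝ × ℝ) × ℝ => abFilling q.1.1 q.1.2.1 q.1.2.2.1 q.1.2.2.2 q.2)
    (g := fun θ : ℝ × ℝ × ℝ × ℝ => θ) (h := fun _ : ℝ × ℝ × ℝ × ℝ => ε) h continuousAt_id continuousAt_const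

end Summit.Ventures.CertifiedManyBodySolver.Downfold.Emery
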